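import Summits.BirchSwinnertonDyer.BirchSwinnertonDyer.Theorems.ThetaPartnerAtTwoMazurTateCongruenceAtTwoRFourFacts
import HarnessLib

/-!
# Glue `MazurTateCongruenceAtTwoTopGlue` (stmt-BirchSwinnertonDyer-27437) of route `ThetaPartnerAtTwo`, K1 row:
# `PublishedInputsHeckeAtTwo → CuspSpanEvenAtTwoOdd → MazurTateCongruenceAtTwoTop`

The split of the crux `MazurTateCongruenceAtTwoTop` (stmt-25797, = `MazurTateCongruenceAtTwoR` 21416 BY NAME) filed by the
route pen (WINDOW 8″, rev 40): the PUB⁵ bundle `PublishedInputsHeckeAtTwo` (27435: Eichler–Shimura period lattice of the depleted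
optimal quotient ∧ Hecke self-duality of `J₀(N)`-torsion ∧ Buzzard 2000 multiplicity one mod `2` on `Γ₀` ∧ Serre 1972 supersingular
decomposition-subgroup image ∧ Abbes–Ullmo Thm A) and the shared curve-free node `CuspSpanEvenAtTwoOdd` (27436, the statement
`SignedMuAtTwo.CuspSpanEvenAtTwo N` for every odd `N`, inlined) imply the parent. The proof is the width seat tp2-p1-w2 g2's
`MazurTateCongruenceAtTwoR.mazurTateCongruenceAtTwoTop_of_fiveFacts_cuspSpan` (p622986, `…RFourFacts.lean`), the node hypothesis
being passed through by definitional unfolding of `SignedMuAtTwo.CuspSpanEvenAtTwo`.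

HONEST FRAMING: this closes the GLUE item only (an implication); the PUB⁵ bundle (published theorems at grade cite_only) and the
node (conjecture-grade, open for general odd `N`) remain hypotheses; nothing here proves BSD or any case of it.

References: [GreenbergVatsal2000] Thm. (1.4), §3 (13); [Vatsal1999] (1.13); [Pollack2003] Conj. 6.3.
-/

-- justification: the `Summit.BirchSwinnertonDyer.BirchSwinnertonDyer.…` path repeats a component (route-file convention)
set_option linter.dupNamespace false
set_option autoImplicit false

namespace Summit.BirchSwinnertonDyer.BirchSwinnertonDyer.Theorems.MazurTateCongruenceAtTwoR

open Summit.BirchSwinnertonDyer.BirchSwinnertonDyer.Theses.ThetaPartnerAtTwo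

/-- **Glue of the split of `MazurTateCongruenceAtTwoTop` (stmt-BirchSwinnertonDyer-27437).** The five published Hecke-side inputs
and the curve-free node «`CuspSpanEvenAtTwo N` for every odd `N`» imply the oriented `S₀`-depleted Mazur–Tate congruence at even
layers for theta pairs at `p = 2` — by `mazurTateCongruenceAtTwoTop_of_fiveFacts_cuspSpan` (p622986). An implication only: neither
hypothesis is asserted. [cite: GreenbergVatsal2000, Thm. (1.4) and §3 (13)] [cite: Pollack2003, Conj. 6.3] -/
theorem mazurTateCongruenceAtTwoTopGlue_proof : MazurTateCongruenceAtTwoTopGlue := by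
  rintro ⟨hES, hSD, hBz, hSe, hAU⟩ hG
  exact mazurTateCongruenceAtTwoTop_of_fiveFacts_cuspSpan hES hSD hBz hSe hAU (fun N _ hN => hG N hN)

end Summit.BirchSwinnertonDyer.BirchSwinnertonDyer.Theorems.MazurTateCongruenceAtTwoR
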